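import Summits.BirchSwinnertonDyer.Rank1Residual.GaloisImage.HauptmodulDeltaUnitValuation
import HarnessLib

/-!
# The level-`9` Hauptmodul at `v₃(j) = 3`, `j/27 ≡ 2 (mod 9)` is VALUATION-FORCED:
# `v((3θ/(S − 3))² − 1)⁹ = v(3)` — the `L ≡ 2` twin of `HauptmodulNineValuationThree` (`L ≡ 5`)
# (cell `b2b-bsdres`, team n1011, seat p02 gen 6 — row T-b11-F4-END, file F4c-H23 'Hauptmodul route,
# curve-free core at v₃(j) = 3, j/27 ≡ 2 (mod 9)'; pure valuation algebra in `ℚ̄`)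

HONEST FRAMING (cell `b2b-bsdres`, run/shared/lean/b2b/bsd-rank1-residual/, verbatim in every
file): the goal of the cell is to DELETE the COMBINATION-SHAPED residual classes of the
Birch–Swinnerton-Dyer formula for ALL analytic-rank `≤ 1` elliptic curves over `ℚ` — "full BSD
formula for every rank `≤ 1` curve in class `C`" assembled STRICTLY from published theorems — so
that the rank-`≤ 1` remainder becomes exactly the CONSTRUCTION-SHAPED classes, which are TYPED
(missing-input `Prop`s), NOT attempted. This is not "finishing BSD". Team n1011 (N10 / N11):
research route; no claim beyond the stated classes; labels UNCHANGED; nothing is booked. Theorems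
only (no definition, no named fact).

## What this file proves

`v` the place of `ℚ̄` over `3`, `t = v(3)`; `L = j/27`, `S = 3u + 3` the non-canonical level-`3`
Hauptmodul (`v(S) = t`, so `u + 1` is a unit), `u⁴ − 20u³ + 126u² − (196 + L)u + (8L − 343) = 0`
(`HauptmodulThreeQuarticValuation.rho_quartic_of_hauptmodul_three`), `v(u)³ = t`
(`HauptmodulJ27QuarticValuation.valuation_u_pow_three_eq`).

* `valuation_facts_of_sub_two` (§0) — from `v(L − 2) ≤ t²`: `v(8L − 343) = t`, `v(196 + L) ≤ t`,
  `v(403 − 8L) ≤ t²`, `v(253 + L) = t`, `v(8L − 283) = t`, `v(139 + L) ≤ t`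
  (`327 = 3·109`, `198 = 9·22`, `387 = 9·43`, `255 = 3·85`, `267 = 3·89`, `141 = 3·47`).
* `valuation_factors_of_quartic_three_two` (§1) — `v(G₋)·v(G₊) = t²·v(u)` for
  `G₋ = (403 − 8L) + (253 + L)u − 129u²` (now the LINEAR term dominates: `v(G₋) = t·v(u)`) and
  `G₊ = (8L − 283) − (139 + L)u + 123u²` (now the CONSTANT dominates: `v(G₊) = t`).
* **`valuation_hauptmodul_nine_invariant_three_two_pow_nine`** (§2) — `9 ∣ num(j/27 − 2)`,
  `j(S − 27) = S(S − 24)³`, `v(S) = t`, `θ³ = S` ⟹ **`v((3θ/(S − 3))² − 1)⁹ = t`** — valuation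
  exactly `1/9` (`X = θ²/u²`, `(X³ − 1)u⁶(20 − u)² = G₋G₊`, so `v(X³ − 1) = t^{1/3}`; cube-root lemma).

At `v₃(j) = 3` the EXOTIC core requires `j/27 ≡ 2 (mod 3)` (else `v₃(j − 1728) ≥ 4`), i.e.
`j/27 mod 9 ∈ {2, 5, 8}`: `5` is gen 5's `HauptmodulNineTowerThree` (84 cells), `2` is this file
(NO cell of the census; EVIDENCE on synthetic `j = 27L`, `L ∈ {2, 11, 20, 1/5, 7/8}`: `e = 9` and
`ord z = 1/9`, kit j137075 5/5), `8` is the 'tame' class (27 cells, no prime of `ℚ(θ)` with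
`9 ∣ ef`).  Filed for the sharpness of the EXOTIC signature.  Nothing booked.

References: [Maier2006] Table 4 (N = 3, 9), §5.
-/

noncomputable section

set_option maxRecDepth 10000

open scoped Classical

namespace Summit.BirchSwinnertonDyer.Rank1Residual.GaloisImage

open Literature.NumberTheory.EllipticCurves Literature.NumberTheory.GaloisRepresentations
  Rat.HeightOneSpectrum

/-! ### §0 Consequences of `L ≡ 2 (mod 9)` -/

/-- The six valuation facts from `v(L − 2) ≤ v(3)²`: `8L − 343 = 8(L − 2) − 3·109`,
`196 + L = 9·22 + (L − 2)`, `403 − 8L = 9·43 − 8(L − 2)`, `253 + L = 3·85 + (L − 2)`,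
`8L − 283 = 8(L − 2) − 3·89`, `139 + L = 3·47 + (L − 2)`. [folklore] -/
theorem valuation_facts_of_sub_two {L : AlgebraicClosure ℚ}
    (hL : (placeOver 3).valuation (L - 2) ≤ (placeOver 3).valuation (3 : AlgebraicClosure ℚ) ^ 2) :
    (placeOver 3).valuation (8 * L - 343) = (placeOver 3).valuation (3 : AlgebraicClosure ℚ) ∧
    (placeOver 3).valuation (196 + L) ≤ (placeOver 3).valuation (3 : AlgebraicClosure ℚ) ∧
    (placeOver 3).valuation (403 - 8 * L) ≤ (placeOver 3).valuation (3 : AlgebraicClosure ℚ) ^ 2 ∧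
    (placeOver 3).valuation (253 + L) = (placeOver 3).valuation (3 : AlgebraicClosure ℚ) ∧
    (placeOver 3).valuation (8 * L - 283) = (placeOver 3).valuation (3 : AlgebraicClosure ℚ) ∧
    (placeOver 3).valuation (139 + L) ≤ (placeOver 3).valuation (3 : AlgebraicClosure ℚ) := by
  set v := (placeOver 3).valuation with hv
  set t := v (3 : AlgebraicClosure ℚ) with ht
  have ht1 : t < 1 := valuation_three_lt_one
  have ht0 : t ≠ 0 := valuation_three_ne_zero
  have hunit : ∀ n : ℤ, ¬ (3 : ℤ) ∣ n → v (n : AlgebraicClosure ℚ) = 1 := fun n hn ↦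
    valuation_intCast_eq_one_of_not_dvd hn
  have ht2t : t ^ 2 < t := by
    calc t ^ 2 = t * t := pow_two t
      _ < t * 1 := mul_lt_mul_of_pos_left ht1 (zero_lt_iff.mpr ht0)
      _ = t := mul_one t
  have h8 : v (8 * (L - 2)) ≤ t ^ 2 := by
    rw [map_mul]
    calc v 8 * v (L - 2) ≤ 1 * t ^ 2 := mul_le_mul' (by
          have := hunit 8 (by decide); exact_mod_cast this.le) hL
      _ = t ^ 2 := one_mul _
  -- `v(3·k) = t` and `v(9·k) = t²` for `k` prime to `3`
  have h3k : ∀ k : ℤ, ¬ (3 : ℤ) ∣ k → v ((3 * k : ℤ) : AlgebraicClosure ℚ) = t := by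
    intro k hk; rw [Int.cast_mul, map_mul, Int.cast_ofNat, hunit k hk, mul_one]
  have h9k : ∀ k : ℤ, ¬ (3 : ℤ) ∣ k → v ((9 * k : ℤ) : AlgebraicClosure ℚ) = t ^ 2 := by
    intro k hk
    rw [Int.cast_mul, map_mul, show ((9 : ℤ) : AlgebraicClosure ℚ) = 3 ^ 2 by norm_num, map_pow,
      hunit k hk, mul_one]
  refine ⟨?_, ?_, ?_, ?_, ?_, ?_⟩
  · have e : (8 : AlgebraicClosure ℚ) * L - 343 = 8 * (L - 2) - ((3 * 109 : ℤ) : AlgebraicClosure ℚ) := by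
      push_cast; ring
    rw [e, valuation_sub_eq_of_lt' (by rw [h3k 109 (by decide)]; exact h8.trans_lt ht2t),
      h3k 109 (by decide)]
  · have e : (196 : AlgebraicClosure ℚ) + L = ((9 * 22 : ℤ) : AlgebraicClosure ℚ) + (L - 2) := by
      push_cast; ring
    rw [e]
    exact (Valuation.map_add _ _ _).trans (max_le ((h9k 22 (by decide)).le.trans ht2t.le)
      (hL.trans ht2t.le))
  · have e : (403 : AlgebraicClosure ℚ) - 8 * L = ((9 * 43 : ℤ) : AlgebraicClosure ℚ) - 8 * (L - 2) := by
      push_cast; ring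
    rw [e]
    exact (Valuation.map_sub _ _ _).trans (max_le (h9k 43 (by decide)).le h8)
  · have e : (253 : AlgebraicClosure ℚ) + L = ((3 * 85 : ℤ) : AlgebraicClosure ℚ) + (L - 2) := by
      push_cast; ring
    rw [e, Valuation.map_add_eq_of_lt_left _ (by rw [h3k 85 (by decide)]; exact hL.trans_lt ht2t),
      h3k 85 (by decide)]
  · have e : (8 : AlgebraicClosure ℚ) * L - 283 = 8 * (L - 2) - ((3 * 89 : ℤ) : AlgebraicClosure ℚ) := by
      push_cast; ring
    rw [e, valuation_sub_eq_of_lt' (by rw [h3k 89 (by decide)]; exact h8.trans_lt ht2t),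
      h3k 89 (by decide)]
  · have e : (139 : AlgebraicClosure ℚ) + L = ((3 * 47 : ℤ) : AlgebraicClosure ℚ) + (L - 2) := by
      push_cast; ring
    rw [e]
    exact (Valuation.map_add _ _ _).trans (max_le (h3k 47 (by decide)).le (hL.trans ht2t.le))

/-! ### §1 The two factors of `9(u + 1)² − u⁶` at `L ≡ 2 (mod 9)` -/

/-- **`v(G₋)·v(G₊) = v(3)²·v(u)`** for `G₋ = (403 − 8L) + (253 + L)u − 129u²` and
`G₊ = (8L − 283) − (139 + L)u + 123u²`, when `v(403 − 8L) ≤ v(3)²`, `v(253 + L) = v(3)`,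
`v(8L − 283) = v(3)`, `v(139 + L) ≤ v(3)` and `v(u)³ = v(3)`: `v(G₋) = v((253 + L)u) = v(3)v(u)`
and `v(G₊) = v(8L − 283) = v(3)`. [folklore] -/
theorem valuation_factors_of_quartic_three_two {u L : AlgebraicClosure ℚ}
    (h403 : (placeOver 3).valuation (403 - 8 * L) ≤ (placeOver 3).valuation (3 : AlgebraicClosure ℚ) ^ 2)
    (h253 : (placeOver 3).valuation (253 + L) = (placeOver 3).valuation (3 : AlgebraicClosure ℚ))
    (h283 : (placeOver 3).valuation (8 * L - 283) = (placeOver 3).valuation (3 : AlgebraicClosure ℚ))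
    (h139 : (placeOver 3).valuation (139 + L) ≤ (placeOver 3).valuation (3 : AlgebraicClosure ℚ))
    (hu : (placeOver 3).valuation u ^ 3 = (placeOver 3).valuation (3 : AlgebraicClosure ℚ)) :
    (placeOver 3).valuation (403 - 8 * L + (253 + L) * u - 129 * u ^ 2) *
        (placeOver 3).valuation (8 * L - 283 - (139 + L) * u + 123 * u ^ 2) =
      (placeOver 3).valuation (3 : AlgebraicClosure ℚ) ^ 2 * (placeOver 3).valuation u := by
  set v := (placeOver 3).valuation with hv
  set t := v (3 : AlgebraicClosure ℚ) with ht
  set s := v u with hs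
  have ht1 : t < 1 := valuation_three_lt_one
  have ht0 : t ≠ 0 := valuation_three_ne_zero
  have ht0' : 0 < t := zero_lt_iff.mpr ht0
  have hunit : ∀ n : ℤ, ¬ (3 : ℤ) ∣ n → v (n : AlgebraicClosure ℚ) = 1 := fun n hn ↦
    valuation_intCast_eq_one_of_not_dvd hn
  -- orders of magnitude: `t < s < 1`, `s³ = t`
  have hs1 : s < 1 := by
    by_contra h
    rw [not_lt] at h
    have : (1 : _) ≤ s ^ 3 := one_le_pow₀ h
    rw [hu] at this
    exact absurd this (not_le.mpr ht1)
  have hs0' : 0 < s := by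
    rcases eq_or_lt_of_le (zero_le : (0 : _) ≤ s) with h | h
    · exfalso
      have : s ^ 3 = 0 := by rw [← h, zero_pow three_ne_zero]
      rw [hu] at this
      exact ht0 this
    · exact h
  have hts : t < s := by
    refine lt_of_pow_lt_pow_left₀ 3 hs0'.le ?_
    rw [hu]
    calc t ^ 3 = t * t ^ 2 := by rw [← pow_succ']
      _ < t * 1 := mul_lt_mul_of_pos_left (pow_lt_one₀ zero_le ht1 two_ne_zero) ht0'
      _ = t := mul_one t
  -- `G₋`: the linear term dominates
  have hGm : v (403 - 8 * L + (253 + L) * u - 129 * u ^ 2) = t * s := by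
    have hmain : v ((253 + L) * u) = t * s := by rw [map_mul, h253]
    have hc : v (403 - 8 * L) < t * s :=
      h403.trans_lt (by rw [pow_two]; exact mul_lt_mul_of_pos_left hts ht0')
    have hq : v (129 * u ^ 2) < t * s := by
      rw [show (129 : AlgebraicClosure ℚ) = 3 * 43 by norm_num, map_mul, map_mul, map_pow]
      have h43 : v (43 : AlgebraicClosure ℚ) = 1 := by simpa using hunit 43 (by decide)
      rw [h43, mul_one]
      calc t * s ^ 2 = t * s * s := by rw [pow_two, mul_assoc]
        _ < t * s * 1 := mul_lt_mul_of_pos_left hs1 (mul_pos ht0' hs0')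
        _ = t * s := mul_one _
    rw [show (403 - 8 * L + (253 + L) * u - 129 * u ^ 2 : AlgebraicClosure ℚ) =
        (253 + L) * u + (403 - 8 * L - 129 * u ^ 2) by ring,
      Valuation.map_add_eq_of_lt_left _ (by rw [hmain]; exact Valuation.map_sub_lt _ hc hq), hmain]
  -- `G₊`: the constant term dominates
  have hGp : v (8 * L - 283 - (139 + L) * u + 123 * u ^ 2) = t := by
    have hl : v ((139 + L) * u) < t := by
      rw [map_mul]
      calc v (139 + L) * s ≤ t * s := mul_le_mul' h139 le_rfl
        _ < t * 1 := mul_lt_mul_of_pos_left hs1 ht0'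
        _ = t := mul_one t
    have hq : v (123 * u ^ 2) < t := by
      rw [show (123 : AlgebraicClosure ℚ) = 3 * 41 by norm_num, map_mul, map_mul, map_pow]
      have h41 : v (41 : AlgebraicClosure ℚ) = 1 := by simpa using hunit 41 (by decide)
      rw [h41, mul_one]
      calc t * s ^ 2 < t * 1 := mul_lt_mul_of_pos_left (pow_lt_one₀ zero_le hs1 two_ne_zero) ht0'
        _ = t := mul_one t
    rw [show (8 * L - 283 - (139 + L) * u + 123 * u ^ 2 : AlgebraicClosure ℚ) =
        8 * L - 283 + (123 * u ^ 2 - (139 + L) * u) by ring,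
      Valuation.map_add_eq_of_lt_left _ (by rw [h283]; exact Valuation.map_sub_lt _ hq hl), h283]
  rw [hGm, hGp, pow_two, mul_right_comm]

/-! ### §2 Assembly at `v₃(j) = 3`, `j/27 ≡ 2 (mod 9)` -/

/-- **The level-`9` Hauptmodul at `j/27 ≡ 2 (mod 9)` is valuation-forced.**  Let `j ∈ ℚ` with
`9 ∣ num(j/27 − 2)`, and `S, θ ∈ ℚ̄` with `j(S − 27) = S(S − 24)³`, `v(S) = v(3)` and `θ³ = S`.
Then **`v((3θ/(S − 3))² − 1)⁹ = v(3)`** — `3`-adic valuation exactly `1/9`.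
[cite: Maier2006, Table 4 (N = 3, 9) and §5] -/
theorem valuation_hauptmodul_nine_invariant_three_two_pow_nine {j : ℚ}
    (hj2 : (9 : ℤ) ∣ (j / 27 - 2).num) {S θ : AlgebraicClosure ℚ}
    (hS : algebraMap ℚ (AlgebraicClosure ℚ) j * (S - 27) = S * (S - 24) ^ 3)
    (hvS : (placeOver 3).valuation S = (placeOver 3).valuation (3 : AlgebraicClosure ℚ))
    (hθ : θ ^ 3 = S) :
    (placeOver 3).valuation ((3 * θ / (S - 3)) ^ 2 - 1) ^ 9 =
      (placeOver 3).valuation (3 : AlgebraicClosure ℚ) := by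
  set v := (placeOver 3).valuation with hv
  set t := v (3 : AlgebraicClosure ℚ) with ht
  have ht1 : t < 1 := valuation_three_lt_one
  have ht0 : t ≠ 0 := valuation_three_ne_zero
  have h3 : (3 : AlgebraicClosure ℚ) ≠ 0 := by norm_num
  -- `L = j/27 ≡ 2 (mod 9)`
  set L := algebraMap ℚ (AlgebraicClosure ℚ) (j / 27) with hLdef
  have hL2 : v (L - 2) ≤ t ^ 2 := by
    have e : L - 2 = algebraMap ℚ (AlgebraicClosure ℚ) (j / 27 - 2) := by
      rw [map_sub, map_ofNat]
    rw [e]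
    exact valuation_algebraMap_le_sq_of_nine_dvd_num hj2
  obtain ⟨h343, h196, h403, h253, h283, h139⟩ := valuation_facts_of_sub_two hL2
  have hjL : algebraMap ℚ (AlgebraicClosure ℚ) j = 27 * L := by
    rw [hLdef, map_div₀, map_ofNat, mul_div_cancel₀ _ (by norm_num : (27 : AlgebraicClosure ℚ) ≠ 0)]
  -- `u = S/3 − 1`
  obtain ⟨u, hSu⟩ : ∃ u : AlgebraicClosure ℚ, S = 3 * u + 3 := ⟨S / 3 - 1, by field_simp; ring⟩
  subst hSu
  have hq : u ^ 4 - 20 * u ^ 3 + 126 * u ^ 2 - (196 + L) * u + (8 * L - 343) = 0 := by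
    have h := rho_quartic_of_hauptmodul_three hS
    rw [hjL] at h
    have e : (3 * u + 3) / 3 - 2 = u - 1 := by field_simp; ring
    rw [e] at h
    linear_combination h
  have hu1 : v (u + 1) = 1 := by
    have e : u + 1 = (3 * u + 3) / 3 := by field_simp
    rw [e, map_div₀, hvS, div_self ht0]
  have hu := valuation_u_pow_three_eq h343 h196 hu1 hq
  set s := v u with hs
  have hs0 : s ≠ 0 := by
    intro h0; rw [h0, zero_pow three_ne_zero] at hu; exact ht0 hu.symm
  have hu0 : u ≠ 0 := (Valuation.ne_zero_iff _).mp hs0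
  have hG := valuation_factors_of_quartic_three_two h403 h253 h283 h139 hu
  -- `v(20 − u) = 1`
  have hle1 : ∀ n : ℕ, v (n : AlgebraicClosure ℚ) ≤ 1 := fun n ↦
    ((placeOver 3).valuation_le_one_iff _).mpr (natCast_mem (placeOver 3) n)
  have h20u : v (20 - u) = 1 := by
    have e : (20 : AlgebraicClosure ℚ) - u = 21 - (u + 1) := by ring
    have hlt : v (21 : AlgebraicClosure ℚ) < v (u + 1) := by
      rw [hu1, show (21 : AlgebraicClosure ℚ) = 7 * 3 by norm_num, map_mul]
      calc v 7 * t ≤ 1 * t := mul_le_mul' (by exact_mod_cast hle1 7) le_rfl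
        _ = t := one_mul t
        _ < 1 := ht1
    rw [e, valuation_sub_eq_of_lt' hlt, hu1]
  -- the key identity `(9(u + 1)² − u⁶)(20 − u)² = G₋ G₊`
  have hP : u ^ 3 * (20 - u) = (8 * L - 343) - (196 + L) * u + 126 * u ^ 2 := by
    linear_combination -hq
  have hprod : (9 * (u + 1) ^ 2 - u ^ 6) * (20 - u) ^ 2 =
      (403 - 8 * L + (253 + L) * u - 129 * u ^ 2) * (8 * L - 283 - (139 + L) * u + 123 * u ^ 2) := by
    linear_combination (-(u ^ 3 * (20 - u) + ((8 * L - 343) - (196 + L) * u + 126 * u ^ 2))) * hP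
  have h9u : v (9 * (u + 1) ^ 2 - u ^ 6) = t ^ 2 * s := by
    have h := congrArg v hprod
    rw [map_mul, map_mul, map_pow, h20u, one_pow, mul_one] at h
    rw [h]; exact hG
  -- `X = (3θ/(S − 3))² = θ²/u²`, `(X³ − 1)u⁶ = 9(u + 1)² − u⁶`
  have hX : (3 * θ / (3 * u + 3 - 3)) ^ 2 = θ ^ 2 / u ^ 2 := by
    rw [show (3 : AlgebraicClosure ℚ) * u + 3 - 3 = 3 * u by ring, mul_div_mul_left _ _ h3, div_pow]
  have hθ6 : θ ^ 6 = 9 * (u + 1) ^ 2 := by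
    rw [show θ ^ 6 = (θ ^ 3) ^ 2 by ring, hθ]; ring
  have hXu : ((θ ^ 2 / u ^ 2) ^ 3 - 1) * u ^ 6 = 9 * (u + 1) ^ 2 - u ^ 6 := by
    rw [← hθ6]; field_simp
  have hA : v ((θ ^ 2 / u ^ 2) ^ 3 - 1) * s ^ 5 = t ^ 2 := by
    have h := congrArg v hXu
    rw [map_mul, map_pow, h9u, ← hs, show s ^ 6 = s ^ 5 * s by rw [← pow_succ], ← mul_assoc] at h
    exact mul_right_cancel₀ hs0 h
  have hcube : v ((θ ^ 2 / u ^ 2) ^ 3 - 1) ^ 3 = t := by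
    have h := congrArg (· ^ 3) hA
    rw [mul_pow, ← pow_mul, show 5 * 3 = 3 * 5 from rfl, pow_mul, hu] at h
    -- `h : A³ · t⁵ = (t²)³`
    have ht5 : t ^ 5 ≠ 0 := pow_ne_zero _ ht0
    have e : (t ^ 2) ^ 3 = t * t ^ 5 := by rw [← pow_mul, ← pow_succ']
    rw [e] at h
    exact mul_right_cancel₀ ht5 h
  rw [hX]
  exact valuation_sub_one_pow_nine_of_cube hcube

end Summit.BirchSwinnertonDyer.Rank1Residual.GaloisImage
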